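import Literature.AlgebraicGeometry.Motives.AbelianVarietyGoodReductionCofinite
import Literature.NumberTheory.DiophantineGeometry.AbelianSchemeModelSpecialFibre
import HarnessLib

/-!
# The good-reduction datum PRODUCED by an abelian-scheme model, with its group package

Layer `Literature/AlgebraicGeometry/Motives`, namespace `Literature.AlgebraicGeometry.Motives.AbelianVariety`.
THEOREMS ONLY (no definition, no named fact, no instance; net Literature debt **0**).  Written for the cell
`hodgecm-mathlib` (D-0151), fan B-II, line `b2_main_theorem_cm` (crux item stmt-HodgeConjecture-24834), the
FactRH′ COMPANIONS EDITION led by B-p19 (director BATCH 49/60; B-plan1's single reduction binder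
`exists_finite_forall_exists_goodReductionAt_homReduction_conjFrob`), piece **§4′ «produced datum with its group
package»** (B-p19 CARVE 07:05:54Z, signature fixed there).

[Serre–Tate 1968] §1: «`A` has good reduction at `v` if there is an abelian scheme `𝒜` over `𝓞_v` with `𝒜_K ≅ A` …
the special fibre `A_v` is an abelian variety over `k(v)`»; [Bombieri–Gubler 2006] 10.3.9–10.3.10; [Shimura 1998]
§11.1 Prop. 12 (reduction of endomorphisms).  The tree's `GoodReductionAt` datum FORGETS the group law of its model;
the companions construction (Néron lifts of homomorphisms between two data, `HomReduction`) needs it back for the data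
it quantifies over.  `exists_goodReductionAt_of_isAbelianSchemeModel` (B-p07, `Motives/AbelianVarietyGoodReductionCofinite`)
already builds, from an abelian-scheme model `𝒜` of `A` at `v`, a datum `R` with `R.model.total = 𝒜` and
`R.reduction = Ā`; here the SAME construction is re-run exposing what it knows but did not export: the group structure on
`R.model.total` (that of `𝒜`), smoothness and properness of the model, and the facts that the generic isomorphism
`R.model.genericIso : 𝒜_K ≅ A` and the reduction isomorphism `R.reductionIso = 𝟙` are HOMOMORPHISMS of group schemes
(for the group structures induced by the cartesian-monoidal generic-fibre and special-fibre functors).  The nine fields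
of `R` are B-p07's, verbatim (Néron lift at the smooth source for `liftEnd`, special fibre for `redEnd`).

## Main statement
* `exists_goodReductionAt_grpObj_of_isAbelianSchemeModel` — `∃ R (GrpObj R.model.total), Smooth ∧ IsProper ∧
  IsMonHom R.model.genericIso.hom ∧ IsMonHom R.reductionIso.hom ∧ R.reduction = Ā`.

## References
* [SerreTate1968GoodReduction] J.-P. Serre, J. Tate, *Good reduction of abelian varieties*, Ann. of Math. 88 (1968), §1.
* [BombieriGubler2006] E. Bombieri, W. Gubler, *Heights in Diophantine Geometry* (2006), 10.3.9–10.3.10.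
* [Shimura1998] G. Shimura, *Abelian Varieties with Complex Multiplication and Modular Functions* (1998), §11.1 Prop. 12.
* [BLRNeronModels1990] S. Bosch, W. Lütkebohmert, M. Raynaud, *Néron Models* (1990), Prop. 1.2/8.
-/

set_option autoImplicit false

noncomputable section

open CategoryTheory CategoryTheory.Limits AlgebraicGeometry IsDedekindDomain IsDedekindDomain.HeightOneSpectrum MonoidalCategory
open scoped MonObj NumberField CategoryTheory.Obj
open Literature.NumberTheory.EllipticCurves (genericFibre IsNeronModel isNeronModel_of_isProper_of_smooth)
open Literature.NumberTheory.DiophantineGeometry (IsAbelianSchemeModel specialFibreFunctor)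

namespace Literature.AlgebraicGeometry.Motives

namespace AbelianVariety

variable {K : Type} [Field K] [NumberField K]
  {A : AbelianVariety K} {v : HeightOneSpectrum (𝓞 K)}
  {𝒜 : SchemeOver (valuationSubringAtPrime K v)} [GrpObj 𝒜]

/-- **The produced good-reduction datum of an abelian-scheme model, with its group package.**  For an
abelian-scheme model `𝒜` of `A` at `v` (`IsAbelianSchemeModel A v 𝒜`: an `𝓞_{K,v}`-group scheme, smooth of relative
dimension `dim A`, proper, with generic fibre `≅ A` as a group scheme) there is a good-reduction datum `R` of `A` at `v`
TOGETHER WITH: a group-scheme structure on `R.model.total` (it is `𝒜` with its own), `R.model.total → Spec 𝓞_{K,v}`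
smooth and proper, the generic isomorphism `R.model.genericIso : (R.model.total)_K ≅ A` a homomorphism of `K`-group
schemes (for the structure induced by the generic-fibre functor), the reduction isomorphism
`R.reductionIso : Ā ≅ (R.model.total) ×_{𝓞_{K,v}} κ(v)` a homomorphism of `κ(v)`-group schemes (for the structure
induced by the special-fibre functor; it is the identity), and `R.reduction = Ā` the special fibre
(`IsAbelianSchemeModel.specialFibre`).  The datum is B-p07's (`exists_goodReductionAt_of_isAbelianSchemeModel`,
[BombieriGubler2006] 10.3.9, [Shimura1998] §11.1 Prop. 12): `liftEnd` = the Néron lift at the smooth source `𝒜`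
(`isNeronModel_of_isAbelianSchemeModel`), a homomorphism (`isMonHom_of_isMonHom_genericFibre_map`), unital,
multiplicative and additive by uniqueness; `redEnd` = its special fibre.  This is the shape the companions'
datum-intrinsic pair constructor consumes ([SerreTate1968GoodReduction] §1: an abelian scheme is the Néron model of
its generic fibre). [cite: SerreTate1968GoodReduction, §1] [cite: BombieriGubler2006, 10.3.9 (p. 334)]
[cite: Shimura1998, §11.1 Prop. 12 (§11, pp. 83–87)] [cite: BLRNeronModels1990, Prop. 1.2/8] -/
theorem exists_goodReductionAt_grpObj_of_isAbelianSchemeModel (h : IsAbelianSchemeModel A v 𝒜) :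
    ∃ (R : A.GoodReductionAt v) (_ : GrpObj R.model.total),
      Smooth R.model.total.hom ∧ IsProper R.model.total.hom ∧
      @IsMonHom _ _ _ _ _ (Functor.monObjObj (F := genericFibre (valuationSubringAtPrime K v) K)
        (X := R.model.total)) _ R.model.genericIso.hom ∧
      @IsMonHom _ _ _ _ _ _ (Functor.monObjObj (F := specialFibreFunctor v) (X := R.model.total))
        R.reductionIso.hom ∧
      R.reduction = h.specialFibre := by
  classical
  -- adapted from `exists_goodReductionAt_of_isAbelianSchemeModel` (B-p07, `AbelianVarietyGoodReductionCofinite`):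
  -- the same nine fields, with the generic group isomorphism `e` and the group structure of `𝒜` kept in hand
  obtain ⟨e, he⟩ := h.exists_iso
  haveI := he
  have hN := isNeronModel_of_isAbelianSchemeModel h
  haveI := h.isProper
  haveI := h.smooth
  haveI hsm : Smooth 𝒜.hom := SmoothOfRelativeDimension.smooth A.dim 𝒜.hom
  haveI : IsSeparated 𝒜.hom := hN.isSeparated
  -- the Néron bijection `Hom_R(𝒜, 𝒜) ≃ Hom_K(𝒜_K, 𝒜_K)` at the smooth source `𝒜`
  have hbij := hN.mappingProperty 𝒜 ‹Smooth 𝒜.hom›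
  let Φ : (𝒜 ⟶ 𝒜) ≃ ((genericFibre (valuationSubringAtPrime K v) K).obj 𝒜 ⟶
      (genericFibre (valuationSubringAtPrime K v) K).obj 𝒜) := Equiv.ofBijective _ hbij
  -- the extension of the `K`-endomorphisms of `A`, transported along `e`
  let L : End A → (𝒜 ⟶ 𝒜) := fun f => Φ.symm (e.hom ≫ f.hom.hom.hom ≫ e.inv)
  have hL : ∀ f : End A, (genericFibre (valuationSubringAtPrime K v) K).map (L f) =
      e.hom ≫ f.hom.hom.hom ≫ e.inv := fun f => Φ.apply_symm_apply _
  have hinj : Function.Injective fun g : 𝒜 ⟶ 𝒜 => (genericFibre (valuationSubringAtPrime K v) K).map g :=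
    hbij.1
  -- every extension is a homomorphism of group schemes
  have hLmon : ∀ f : End A, IsMonHom (L f) := fun f => by
    haveI : IsMonHom ((genericFibre (valuationSubringAtPrime K v) K).map (L f)) := by
      rw [hL]; infer_instance
    exact isMonHom_of_isMonHom_genericFibre_map K 𝒜 (L f)
  -- the extension is unital, multiplicative (for composition) and additive (pointwise product), by uniqueness
  have hL1 : L 1 = 𝟙 𝒜 := hinj (by
    change (genericFibre _ K).map (L 1) = (genericFibre _ K).map (𝟙 𝒜)
    rw [hL, CategoryTheory.Functor.map_id, End.one_def, AbelianVariety.id_hom, Grp.id_hom_hom]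
    simp)
  have hLmul : ∀ f g : End A, L (f * g) = L g ≫ L f := fun f g => hinj (by
    change (genericFibre _ K).map (L (f * g)) = (genericFibre _ K).map (L g ≫ L f)
    rw [CategoryTheory.Functor.map_comp, hL, hL, hL, End.mul_def, AbelianVariety.comp_hom, Grp.comp_hom_hom]
    simp)
  have hLadd : ∀ f g : End A, L (f + g) = L f * L g := fun f g => hinj (by
    change (genericFibre _ K).map (L (f + g)) = (genericFibre _ K).map (L f * L g)
    rw [Functor.map_mul, hL, hL, hL]
    change e.hom ≫ (f.hom * g.hom).hom.hom ≫ e.inv = _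
    rw [Grp.Hom.hom_mul, Mon.Hom.hom_mul, MonObj.mul_comp, MonObj.comp_mul])
  -- the reduction of endomorphisms: the special fibre of the extension, an endomorphism of `Ā`
  let r : End A → End h.specialFibre := fun f =>
    haveI := hLmon f
    InducedCategory.homMk ((specialFibreFunctor v).mapGrp.map (Grp.ofHom (L f)))
  have hr : ∀ f, (r f).hom.hom.hom = (specialFibreFunctor v).map (L f) := fun f => rfl
  have hr1 : r 1 = 1 := by
    apply AbelianVariety.hom_ext
    rw [hr, hL1]
    change (specialFibreFunctor v).map (𝟙 𝒜) = 𝟙 ((specialFibreFunctor v).obj 𝒜)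
    exact (specialFibreFunctor v).map_id _
  have hrmul : ∀ f g, r (f * g) = r f * r g := fun f g => by
    apply AbelianVariety.hom_ext
    rw [End.mul_def (r f) (r g), hr, hLmul, CategoryTheory.Functor.map_comp]
    rfl
  have hradd : ∀ f g, r (f + g) = r f + r g := fun f g => by
    apply AbelianVariety.hom_ext
    rw [hr, hLadd]
    change (specialFibreFunctor v).map (L f * L g) =
      (specialFibreFunctor v).map (L f) * (specialFibreFunctor v).map (L g)
    exact Functor.map_mul (specialFibreFunctor v) (L f) (L g)
  let ρ : End A →+* End h.specialFibre :=
    RingHom.mk' { toFun := r, map_one' := hr1, map_mul' := hrmul } hradd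
  -- the two compatibilities of the datum (generic fibre of the lift; special fibre of the lift)
  have hlift : ∀ f : End A,
      ((Literature.AlgebraicGeometry.Motives.baseChange (valuationSubringAtPrime K v) K).map (L f)).left ≫
          e.hom.left = e.hom.left ≫ Hom.toSchemeHom (f : A ⟶ A) := fun f => by
    have h1 : (genericFibre (valuationSubringAtPrime K v) K).map (L f) ≫ e.hom = e.hom ≫ f.hom.hom.hom := by
      rw [hL]; simp
    have h2 := congrArg CommaMorphism.left h1
    simp only [Over.comp_left] at h2
    exact h2
  have hred : ∀ f : End A,
      Hom.toSchemeHom (ρ f : h.specialFibre ⟶ h.specialFibre) ≫ (Iso.refl h.specialFibre.X).hom.left =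
        (Iso.refl h.specialFibre.X).hom.left ≫ ((baseChangeHom (residueAt v)).map (L f)).left := fun f => by
    change ((specialFibreFunctor v).map (L f)).left ≫ 𝟙 _ = 𝟙 _ ≫ ((specialFibreFunctor v).map (L f)).left
    simp
  -- the datum (B-p07's nine fields)
  let R : A.GoodReductionAt v :=
    { model := ⟨𝒜, e⟩
      isSmoothProper := ⟨h.smooth, h.isProper⟩
      reduction := h.specialFibre
      reductionIso := Iso.refl _
      dim_reduction := dim_specialFibre_of_isAbelianSchemeModel h
      liftEnd := L
      liftEnd_left_comp := hlift
      redEnd := ρ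
      redEnd_left_comp := hred }
  refine ⟨R, ‹GrpObj 𝒜›, hsm, h.isProper, ?_, ?_, rfl⟩
  · -- the generic isomorphism `e` is a homomorphism of group schemes (`IsAbelianSchemeModel.exists_iso`)
    exact he
  · -- the identity of the special fibre is a homomorphism of group schemes (`reductionIso = Iso.refl`)
    exact (inferInstance : IsMonHom (𝟙 ((specialFibreFunctor v).obj 𝒜)))

end AbelianVariety

end Literature.AlgebraicGeometry.Motives

end
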